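import Summits.QuantumFields.YangMills.Theorems.ContractibleFibreFibreToTorusEnergyChord
import Summits.QuantumFields.YangMills.Theorems.ContractibleFibreFibreToTorusEnergyBoundary
import Summits.QuantumFields.YangMills.Theorems.ContractibleFibreFibreToTorusEnergyFreeBox
import Summits.QuantumFields.YangMills.Theorems.ContractibleFibreFibreToTorusEnergyGeometry
import Summits.QuantumFields.YangMills.Theorems.ContractibleFibreFibreToTorusEnergyDensityBox
import Literature.MathematicalPhysics.QuantumFieldTheory.LatticeGaugeShenZhuZhuProofs
import Literature.MathematicalPhysics.QuantumFieldTheory.YangMillsOS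
import Literature.Probability.LatticeModels.GibbsSpecificationDLRProofs
import HarnessLib

/-!
# The energy of a translation-invariant lattice Yang–Mills Gibbs state is a subgradient of the pressure;
# at differentiability points of the pressure all translation-invariant DLR states have ONE action density

Helper file of crux `FibreToTorus` (stmt-QuantumFields-16244), line `Sketch` (energy programme E6 — assembly of the
landed sub-goals E1 `energy_logNormaliser_chord`, E2 `energy_abs_logNormaliser_sub_logFree_le`,
E3 `energy_tendsto_logFree_box`, E4 `energy_box_geometry`, E5 `energy_integral_wilsonBoundaryAction_box`).

For the Wilson lattice gauge theory of a compact (Hausdorff, second countable) group `G` in a continuous matrix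
representation `ρ` on `ℤ^d`, with pressure `f(β) = freeEnergyDensity d ρ β = lim L^{-d} log ∫ e^{-β S} dU` along tori:

* `energy_pressure_chord` — for every translation-invariant DLR state `μ ∈ 𝒢(β)` and every `β'`,
  `f(β) - (β' - β) e(μ) ≤ f(β')`, where `e(μ) = ∑_{planes (i<j)} (N - ⟨Re tr ρ(U_{p_{ij}})⟩_μ)` is the mean action
  density: the energy of a translation-invariant Gibbs state is a subgradient of the (convex) pressure
  (Friedli–Velenik 2017, Prop. 6.91, (6.117); Lebowitz 1977, §3; here for lattice gauge theory, in the elementary chord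
  form of the tree's Ising file `GibbsEnergyBounds.lean`: Jensen in finite volume for every boundary condition, boundary
  insensitivity of the kernel normaliser, DLR averaging, translation invariance, thermodynamic limit along free boxes).
* `energy_deriv_freeEnergyDensity_eq` — hence, if `f` is differentiable at `β`, `f'(β) = -e(μ)` for EVERY
  translation-invariant `μ ∈ 𝒢(β)`;
* `energy_actionDensity_eq_of_differentiableAt` — so any two translation-invariant DLR states at such a `β` have the same
  mean action density (Friedli–Velenik 2017, Prop. 6.91 / Thm. 6.92 "energy coexistence forces a kink", contrapositive),
  and in `d = 4` the same expectation of the curvature species `actionDensity ρ`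
  (`energy_integral_actionDensity_eq_of_differentiableAt`) — the ENERGY SECTOR of the open stub U_tr
  (`TranslationInvariantUniqueness`) of line `Sketch`, at every differentiability point of the pressure, and the first lemma
  `EnergyCoexistenceKink` of the sibling card `film-transition-sieve`.
-/

noncomputable section

open MeasureTheory Filter Topology Finset
open Literature.Probability.LatticeModels (Site halfOpenBox glueWith IsGibbsMeasure)
open Literature.MathematicalPhysics.QuantumLattice (LGConfig ZdEdge ZdPlaquette plaquetteObs plaquetteEdges
  plaquettesTouching wilsonBoundaryAction ymSpecification ymGibbsMeasures IsZdTranslationInvariant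
  freeEnergyDensity configShift continuous_wilsonBoundaryAction
  continuous_integral_ymSpecification abs_integral_ymSpecification_le
  exists_bound_of_continuous integrable_of_bound measurable_plaquetteObs)
open Literature.MathematicalPhysics.QuantumFieldTheory (haarProbability zdHaar actionDensity
  isSpecification_ymSpecification_of_t2Space exists_bound_trace_re_nonneg)

namespace Summit.QuantumFields.YangMills.Theorems.FibreToTorus

section Assembly

variable {d N : ℕ} {G : Type} [Group G] [TopologicalSpace G] [IsTopologicalGroup G] [CompactSpace G]
  [MeasurableSpace G] [BorelSpace G] [SecondCountableTopology G] [T2Space G]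

/-- Local shorthand: the planes `{(i, j) : i < j}`. -/
local notation3 (prettyPrint := false) "𝔓" d => {q : Fin d × Fin d // q.1 < q.2}

/-- **The energy of a translation-invariant Gibbs state is a subgradient of the pressure** (chord form):
for every translation-invariant `μ ∈ 𝒢(β)` and every `β'`, `f(β) - (β' - β) e(μ) ≤ f(β')` with
`f = freeEnergyDensity d ρ` and `e(μ) = ∑_{planes} (N - ⟨Re tr ρ(U_p)⟩_μ)`.  Proof: in the edge box
`Λ_{n+1} = [0,n+1)^d × {directions}` and for every boundary condition `η`, Jensen gives
`log N_Λ^η(β') ≥ log N_Λ^η(β) - (β'-β) ⟨S_Λ⟩^η_β` (E1); `log N_Λ^η` is within `|β|(N+M)·#∂` of the free-box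
`log Z(𝔅_n)` uniformly in `η` (E2, E4); integrating against `μ(dη)` the DLR equations turn `∫⟨S_Λ⟩^η_β dμ` into
`⟨S_Λ⟩_μ = n^d e(μ) + O(#∂)` (E5, translation invariance); dividing by `(n+1)^d` and letting `n → ∞` (E3:
`(n+1)^{-d} log Z(𝔅_n) → f`; E4: `#∂/(n+1)^d → 0`). [cite: FriedliVelenik2017, Prop. 6.91 (6.117)] -/
theorem energy_pressure_chord (ρ : G →* Matrix (Fin N) (Fin N) ℂ) (hρ : Continuous ρ)
    {β : ℝ} (β' : ℝ) {μ : Measure (LGConfig d G)} (hμ : μ ∈ ymGibbsMeasures (d := d) ρ β)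
    (hμT : IsZdTranslationInvariant μ) :
    freeEnergyDensity d ρ β -
        (β' - β) * ∑ q : 𝔓 d, ((N : ℝ) - ∫ U, plaquetteObs ρ 0 q.1.1 q.1.2 U ∂μ) ≤
      freeEnergyDensity d ρ β' := by
  classical
  have hE1 := energy_logNormaliser_chord d N G ρ hρ
  have hE2 := energy_abs_logNormaliser_sub_logFree_le d N G ρ hρ
  have hE3 := energy_tendsto_logFree_box d N G ρ hρ
  have hE4 := energy_box_geometry d
  have hE5 := energy_integral_wilsonBoundaryAction_box d N G ρ hρ
  have hμG : IsGibbsMeasure (ymSpecification ρ β) μ := hμ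
  haveI : IsProbabilityMeasure μ := hμG.isProbabilityMeasure
  obtain ⟨M, hM0, hM⟩ := exists_bound_trace_re_nonneg ρ hρ
  -- notation
  set e : ℝ := ∑ q : 𝔓 d, ((N : ℝ) - ∫ U, plaquetteObs ρ 0 q.1.1 q.1.2 U ∂μ) with he
  set D : ℝ := (Fintype.card (𝔓 d) : ℝ) with hD
  let Λ : ℕ → Finset (ZdEdge d) := fun n => halfOpenBox d (n + 1) ×ˢ (Finset.univ : Finset (Fin d))
  let B : ℕ → Finset (ZdPlaquette d) := fun n => halfOpenBox d n ×ˢ (Finset.univ : Finset (𝔓 d))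
  let Z : ℝ → ℕ → ℝ := fun b n => ∫ U, ∏ p ∈ B n,
    Real.exp (-b * ((N : ℝ) - plaquetteObs ρ p.1 p.2.1.1 p.2.1.2 U)) ∂(zdHaar d G)
  let bdry : ℕ → ℝ := fun n => (#(plaquettesTouching (Λ n) \ B n) : ℝ)
  let W : ℕ → LGConfig d G → ℝ := fun n U => wilsonBoundaryAction ρ (Λ n) U
  -- the key finite-volume inequality
  have key : ∀ n : ℕ,
      Real.log (Z β n) - (β' - β) * ((n : ℝ) ^ d * e) ≤
        Real.log (Z β' n) + ((|β| + |β'|) * (N + M) + |β' - β| * (N + M)) * bdry n := by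
    intro n
    obtain ⟨hBsub, hBedges, -⟩ := hE4 n
    -- E2 at β and β'
    have h2 : ∀ (b : ℝ) (η : LGConfig d G),
        |Real.log (∫ ζ, Real.exp (-b * W n (glueWith (Λ n) ζ η))
            ∂(MeasureTheory.Measure.pi fun _ : ↥(Λ n) => haarProbability G)) - Real.log (Z b n)| ≤
          |b| * (N + M) * bdry n :=
      fun b η => hE2 M hM (Λ n) (B n) hBsub hBedges η b
    -- E1 + E2: for every boundary condition
    have hpt : ∀ η : LGConfig d G,
        Real.log (Z β n) - |β| * (N + M) * bdry n -
            (β' - β) * ∫ U, W n U ∂(ymSpecification ρ β (Λ n) η) ≤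
          Real.log (Z β' n) + |β'| * (N + M) * bdry n := by
      intro η
      have h1 := hE1 (Λ n) η β β'
      have hb := abs_sub_le_iff.1 (h2 β η)
      have hb' := abs_sub_le_iff.1 (h2 β' η)
      linarith [hb.1, hb.2, hb'.1, hb'.2]
    -- integrate against `μ(dη)`: the kernel average of `W n` is bounded and continuous in `η`
    have hWc : Continuous (W n) := continuous_wilsonBoundaryAction ρ hρ (Λ n)
    obtain ⟨CW, hCW⟩ := exists_bound_of_continuous hWc
    have hγi : Integrable (fun η => ∫ U, W n U ∂(ymSpecification ρ β (Λ n) η)) μ :=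
      integrable_of_bound (continuous_integral_ymSpecification ρ hρ β (Λ n) hWc hCW).aestronglyMeasurable
        (abs_integral_ymSpecification_le ρ hρ β (Λ n) hCW)
    have hDLR : ∫ η, (∫ U, W n U ∂(ymSpecification ρ β (Λ n) η)) ∂μ = ∫ U, W n U ∂μ :=
      hμG.integral_integral_eq (isSpecification_ymSpecification_of_t2Space ρ hρ β) (Λ n)
        (integrable_of_bound hWc.aestronglyMeasurable hCW)
    have hint : Real.log (Z β n) - |β| * (N + M) * bdry n - (β' - β) * ∫ U, W n U ∂μ ≤
        Real.log (Z β' n) + |β'| * (N + M) * bdry n := by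
      have hi1 : Integrable (fun η : LGConfig d G => Real.log (Z β n) - |β| * (N + M) * bdry n -
          (β' - β) * ∫ U, W n U ∂(ymSpecification ρ β (Λ n) η)) μ :=
        (integrable_const _).sub (hγi.const_mul (β' - β))
      have hmono := integral_mono hi1 (integrable_const _) hpt
      rw [integral_sub (integrable_const _) (hγi.const_mul _), integral_const_mul, hDLR,
        integral_const, integral_const] at hmono
      simpa [measure_univ] using hmono
    -- E5: the `μ`-energy of the box
    have hprod : |(β' - β) * ((∫ U, W n U ∂μ) - (n : ℝ) ^ d * e)| ≤ |β' - β| * ((N + M) * bdry n) := by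
      rw [abs_mul]
      exact mul_le_mul_of_nonneg_left (hE5 M hM μ inferInstance hμT n hBsub) (abs_nonneg _)
    have hprod' := abs_le.1 hprod
    nlinarith [hprod'.1, hprod'.2, hint]
  -- divide by `(n+1)^d` and pass to the limit
  have hpos : ∀ n : ℕ, (0 : ℝ) < ((n + 1 : ℕ) : ℝ) ^ d := fun n => by positivity
  have h_n_over : Tendsto (fun n : ℕ => (n : ℝ) / ((n : ℝ) + 1)) atTop (𝓝 1) := by
    have h : Tendsto (fun n : ℕ => 1 - 1 / ((n : ℝ) + 1)) atTop (𝓝 (1 - 0)) :=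
      tendsto_const_nhds.sub (tendsto_one_div_add_atTop_nhds_zero_nat)
    rw [sub_zero] at h
    refine h.congr fun n => ?_
    have : (n : ℝ) + 1 ≠ 0 := by positivity
    field_simp
    ring
  have hlim_bdry : Tendsto (fun n : ℕ => (((n + 1 : ℕ) : ℝ) ^ d)⁻¹ * bdry n) atTop (𝓝 0) := by
    -- `0 ≤ bdry n / (n+1)^d ≤ D ((n+2)^d - n^d) / (n+1)^d → 0`
    have hup : ∀ n : ℕ, (((n + 1 : ℕ) : ℝ) ^ d)⁻¹ * bdry n ≤
        D * ((((n : ℝ) + 2) / ((n : ℝ) + 1)) ^ d - (((n : ℝ)) / ((n : ℝ) + 1)) ^ d) := fun n => by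
      obtain ⟨-, -, hcard⟩ := hE4 n
      have hn1' : ((n : ℝ) + 1) ^ d ≠ 0 := by positivity
      calc (((n + 1 : ℕ) : ℝ) ^ d)⁻¹ * bdry n
          ≤ (((n + 1 : ℕ) : ℝ) ^ d)⁻¹ * (D * (((n : ℝ) + 2) ^ d - (n : ℝ) ^ d)) :=
            mul_le_mul_of_nonneg_left hcard (inv_nonneg.2 (hpos n).le)
        _ = D * ((((n : ℝ) + 2) / ((n : ℝ) + 1)) ^ d - (((n : ℝ)) / ((n : ℝ) + 1)) ^ d) := by
            rw [div_pow, div_pow, ← sub_div]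
            push_cast
            field_simp
    have hlow : ∀ n : ℕ, 0 ≤ (((n + 1 : ℕ) : ℝ) ^ d)⁻¹ * bdry n := fun n =>
      mul_nonneg (inv_nonneg.2 (hpos n).le) (Nat.cast_nonneg _)
    have h1 : Tendsto (fun n : ℕ => ((n : ℝ) + 2) / ((n : ℝ) + 1)) atTop (𝓝 1) := by
      have h : Tendsto (fun n : ℕ => 1 + 1 / ((n : ℝ) + 1)) atTop (𝓝 (1 + 0)) :=
        tendsto_const_nhds.add (tendsto_one_div_add_atTop_nhds_zero_nat)
      rw [add_zero] at h
      refine h.congr fun n => ?_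
      have : (n : ℝ) + 1 ≠ 0 := by positivity
      field_simp
      ring
    have h3 : Tendsto (fun n : ℕ => D * ((((n : ℝ) + 2) / ((n : ℝ) + 1)) ^ d -
        (((n : ℝ)) / ((n : ℝ) + 1)) ^ d)) atTop (𝓝 (D * (1 ^ d - 1 ^ d))) :=
      ((h1.pow d).sub (h_n_over.pow d)).const_mul D
    rw [sub_self, mul_zero] at h3
    exact tendsto_of_tendsto_of_tendsto_of_le_of_le tendsto_const_nhds h3 hlow hup
  have hlim_ratio : Tendsto (fun n : ℕ => (((n + 1 : ℕ) : ℝ) ^ d)⁻¹ * (n : ℝ) ^ d) atTop (𝓝 1) := by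
    have h := h_n_over.pow d
    rw [one_pow] at h
    refine h.congr fun n => ?_
    push_cast
    rw [div_pow, inv_mul_eq_div]
  -- left side → f(β) - (β'-β) e ; right side → f(β')
  have hL : Tendsto (fun n : ℕ => (((n + 1 : ℕ) : ℝ) ^ d)⁻¹ * Real.log (Z β n) -
      (β' - β) * ((((n + 1 : ℕ) : ℝ) ^ d)⁻¹ * (n : ℝ) ^ d * e)) atTop
      (𝓝 (freeEnergyDensity d ρ β - (β' - β) * (1 * e))) :=
    (hE3 β).sub ((hlim_ratio.mul_const e).const_mul (β' - β))
  rw [one_mul] at hL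
  have hR : Tendsto (fun n : ℕ => (((n + 1 : ℕ) : ℝ) ^ d)⁻¹ * Real.log (Z β' n) +
      ((|β| + |β'|) * (N + M) + |β' - β| * (N + M)) * ((((n + 1 : ℕ) : ℝ) ^ d)⁻¹ * bdry n)) atTop
      (𝓝 (freeEnergyDensity d ρ β' + ((|β| + |β'|) * (N + M) + |β' - β| * (N + M)) * 0)) :=
    (hE3 β').add (hlim_bdry.const_mul _)
  rw [mul_zero, add_zero] at hR
  refine le_of_tendsto_of_tendsto' hL hR fun n => ?_
  have hk := mul_le_mul_of_nonneg_left (key n) (inv_nonneg.2 (hpos n).le)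
  have hexp : (((n + 1 : ℕ) : ℝ) ^ d)⁻¹ * (Real.log (Z β n) - (β' - β) * ((n : ℝ) ^ d * e)) =
      (((n + 1 : ℕ) : ℝ) ^ d)⁻¹ * Real.log (Z β n) -
        (β' - β) * ((((n + 1 : ℕ) : ℝ) ^ d)⁻¹ * (n : ℝ) ^ d * e) := by ring
  have hexp' : (((n + 1 : ℕ) : ℝ) ^ d)⁻¹ *
      (Real.log (Z β' n) + ((|β| + |β'|) * (N + M) + |β' - β| * (N + M)) * bdry n) =
      (((n + 1 : ℕ) : ℝ) ^ d)⁻¹ * Real.log (Z β' n) +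
        ((|β| + |β'|) * (N + M) + |β' - β| * (N + M)) * ((((n + 1 : ℕ) : ℝ) ^ d)⁻¹ * bdry n) := by
    ring
  rw [hexp, hexp'] at hk
  exact hk

omit [Group G] [TopologicalSpace G] [IsTopologicalGroup G] [CompactSpace G] [MeasurableSpace G] [BorelSpace G]
  [SecondCountableTopology G] [T2Space G] in
/-- **A supporting line at a point of differentiability is the tangent**: if `g x + s (y - x) ≤ g y` for all `y`
and `g` is differentiable at `x`, then `deriv g x = s` (`y ↦ g y - s (y - x)` has a minimum at `x`). [folklore] -/
theorem deriv_eq_of_supporting_line {g : ℝ → ℝ} {x s : ℝ} (hsupp : ∀ y, g x + s * (y - x) ≤ g y)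
    (hdiff : DifferentiableAt ℝ g x) : deriv g x = s := by
  have hφ : IsLocalMin (fun y => g y - s * (y - x)) x :=
    Filter.Eventually.of_forall fun y => by
      show g x - s * (x - x) ≤ g y - s * (y - x)
      linarith [hsupp y]
  have h1 : HasDerivAt (fun y => g y - s * (y - x)) (deriv g x - s * 1) x :=
    hdiff.hasDerivAt.sub (((hasDerivAt_id' x).sub_const x).const_mul s)
  have h0 := hφ.hasDerivAt_eq_zero h1
  linarith

/-- **The derivative of the pressure is minus the action density of every translation-invariant Gibbs state**:
if `f = freeEnergyDensity d ρ` is differentiable at `β`, then `f'(β) = -e(μ)` for every translation-invariant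
`μ ∈ 𝒢(β)` (Friedli–Velenik 2017, Prop. 6.91 / Thm. 6.92, at a differentiability point the subgradient is unique).
[cite: FriedliVelenik2017, Prop. 6.91] -/
theorem energy_deriv_freeEnergyDensity_eq (ρ : G →* Matrix (Fin N) (Fin N) ℂ) (hρ : Continuous ρ) {β : ℝ}
    (hdiff : DifferentiableAt ℝ (freeEnergyDensity d ρ) β) {μ : Measure (LGConfig d G)}
    (hμ : μ ∈ ymGibbsMeasures (d := d) ρ β) (hμT : IsZdTranslationInvariant μ) :
    deriv (freeEnergyDensity d ρ) β = -∑ q : 𝔓 d, ((N : ℝ) - ∫ U, plaquetteObs ρ 0 q.1.1 q.1.2 U ∂μ) := by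
  refine deriv_eq_of_supporting_line (fun β' => ?_) hdiff
  have h := energy_pressure_chord ρ hρ β' hμ hμT
  linarith

/-- **At a differentiability point of the pressure, all translation-invariant DLR states have the same mean action
density** (Friedli–Velenik 2017, Prop. 6.91 / Thm. 6.92, contrapositive of "energy coexistence forces a kink"; the energy
sector of weak-coupling translation-invariant uniqueness `TranslationInvariantUniqueness`, stub U_tr of line `Sketch`).
[cite: FriedliVelenik2017, Prop. 6.91] -/
theorem energy_actionDensity_eq_of_differentiableAt (ρ : G →* Matrix (Fin N) (Fin N) ℂ) (hρ : Continuous ρ)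
    {β : ℝ} (hdiff : DifferentiableAt ℝ (freeEnergyDensity d ρ) β) {μ ν : Measure (LGConfig d G)}
    (hμ : μ ∈ ymGibbsMeasures (d := d) ρ β) (hν : ν ∈ ymGibbsMeasures (d := d) ρ β)
    (hμT : IsZdTranslationInvariant μ) (hνT : IsZdTranslationInvariant ν) :
    ∑ q : 𝔓 d, ∫ U, plaquetteObs ρ 0 q.1.1 q.1.2 U ∂μ = ∑ q : 𝔓 d, ∫ U, plaquetteObs ρ 0 q.1.1 q.1.2 U ∂ν := by
  have h1 := energy_deriv_freeEnergyDensity_eq ρ hρ hdiff hμ hμT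
  have h2 := energy_deriv_freeEnergyDensity_eq ρ hρ hdiff hν hνT
  rw [h1] at h2
  have h3 := neg_injective h2
  rw [Finset.sum_sub_distrib, Finset.sum_sub_distrib] at h3
  linarith

end Assembly

section FourDim

variable {N : ℕ} {G : Type} [Group G] [TopologicalSpace G] [IsTopologicalGroup G] [CompactSpace G]
  [MeasurableSpace G] [BorelSpace G] [SecondCountableTopology G] [T2Space G]

omit [TopologicalSpace G] [IsTopologicalGroup G] [CompactSpace G] [MeasurableSpace G] [BorelSpace G]
  [SecondCountableTopology G] [T2Space G] in
/-- The Wilson action density at the origin as a sum over the planes `{(i, j) : i < j}`. [folklore] -/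
theorem actionDensity_eq_sum_subtype (ρ : G →* Matrix (Fin N) (Fin N) ℂ) (U : LGConfig 4 G) :
    actionDensity ρ U = ∑ q : {q : Fin 4 × Fin 4 // q.1 < q.2}, plaquetteObs ρ 0 q.1.1 q.1.2 U := by
  unfold actionDensity
  rw [← Finset.sum_product' (f := fun i j => if i < j then plaquetteObs ρ 0 i j U else 0),
    ← Finset.sum_filter, ← Finset.sum_subtype_eq_sum_filter]
  rfl

/-- **Four dimensions: at a differentiability point of the pressure, all translation-invariant DLR states have the same
expectation of the curvature species** `actionDensity ρ = ∑_{i<j} Re tr ρ(U_{p_{ij}(0)})` (the `F` of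
`LatticeRep.curvature`). [cite: FriedliVelenik2017, Prop. 6.91] -/
theorem energy_integral_actionDensity_eq_of_differentiableAt (ρ : G →* Matrix (Fin N) (Fin N) ℂ)
    (hρ : Continuous ρ) {β : ℝ} (hdiff : DifferentiableAt ℝ (freeEnergyDensity 4 ρ) β)
    {μ ν : Measure (LGConfig 4 G)} (hμ : μ ∈ ymGibbsMeasures (d := 4) ρ β) (hν : ν ∈ ymGibbsMeasures (d := 4) ρ β)
    (hμT : IsZdTranslationInvariant μ) (hνT : IsZdTranslationInvariant ν) :
    ∫ U, actionDensity ρ U ∂μ = ∫ U, actionDensity ρ U ∂ν := by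
  have hμG : IsGibbsMeasure (ymSpecification ρ β) μ := hμ
  have hνG : IsGibbsMeasure (ymSpecification ρ β) ν := hν
  haveI : IsProbabilityMeasure μ := hμG.isProbabilityMeasure
  haveI : IsProbabilityMeasure ν := hνG.isProbabilityMeasure
  obtain ⟨M, -, hM⟩ := exists_bound_trace_re_nonneg ρ hρ
  have hint : ∀ (κ : Measure (LGConfig 4 G)) [IsProbabilityMeasure κ] (q : {q : Fin 4 × Fin 4 // q.1 < q.2}),
      Integrable (fun U => plaquetteObs ρ 0 q.1.1 q.1.2 U) κ := fun κ _ q =>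
    integrable_of_bound (measurable_plaquetteObs ρ hρ 0 q.1.1 q.1.2).aestronglyMeasurable (C := M)
      fun U => by unfold plaquetteObs; exact hM _
  simp only [actionDensity_eq_sum_subtype]
  rw [integral_finsetSum _ fun q _ => hint μ q, integral_finsetSum _ fun q _ => hint ν q]
  exact energy_actionDensity_eq_of_differentiableAt ρ hρ hdiff hμ hν hμT hνT

end FourDim

section Registered

/-- **Registered form (helper sub-goal `energy_pressure_chord_closed`)**: the energy of a translation-invariant lattice
Yang–Mills Gibbs state is a subgradient of the pressure, closed over all parameters. [cite: FriedliVelenik2017, Prop. 6.91 (6.117)] -/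
theorem energy_pressure_chord_closed : ∀ (d N : ℕ) (G : Type) [Group G] [TopologicalSpace G] [IsTopologicalGroup G] [CompactSpace G] [MeasurableSpace G] [BorelSpace G] [SecondCountableTopology G] [T2Space G] (ρ : G →* Matrix (Fin N) (Fin N) ℂ), Continuous ρ → ∀ (β β' : ℝ) (μ : MeasureTheory.Measure (LGConfig d G)), μ ∈ ymGibbsMeasures (d := d) ρ β → IsZdTranslationInvariant μ → freeEnergyDensity d ρ β - (β' - β) * ∑ q : {q : Fin d × Fin d // q.1 < q.2}, ((N : ℝ) - ∫ U, plaquetteObs ρ 0 q.1.1 q.1.2 U ∂μ) ≤ freeEnergyDensity d ρ β' :=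
  fun _ _ _ _ _ _ _ _ _ _ _ ρ hρ _ β' _ hμ hμT => energy_pressure_chord ρ hρ β' hμ hμT

/-- **Registered form (helper sub-goal `energy_uniqueActionDensity_of_differentiableAt`)**: in four dimensions, at
every `β` where the pressure is differentiable, all translation-invariant DLR states of the Wilson specification have
the same expectation of the curvature species `actionDensity ρ` — the energy sector of stub U_tr of line `Sketch`.
[cite: FriedliVelenik2017, Prop. 6.91] -/
theorem energy_uniqueActionDensity_of_differentiableAt : ∀ (N : ℕ) (G : Type) [Group G] [TopologicalSpace G] [IsTopologicalGroup G] [CompactSpace G] [MeasurableSpace G] [BorelSpace G] [SecondCountableTopology G] [T2Space G] (ρ : G →* Matrix (Fin N) (Fin N) ℂ), Continuous ρ → ∀ β : ℝ, DifferentiableAt ℝ (freeEnergyDensity 4 ρ) β → ∀ μ ν : MeasureTheory.Measure (LGConfig 4 G), μ ∈ ymGibbsMeasures (d := 4) ρ β → ν ∈ ymGibbsMeasures (d := 4) ρ β → IsZdTranslationInvariant μ → IsZdTranslationInvariant ν → ∫ U, actionDensity ρ U ∂μ = ∫ U, actionDensity ρ U ∂ν :=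
  fun _ _ _ _ _ _ _ _ _ _ ρ hρ _ hdiff _ _ hμ hν hμT hνT =>
    energy_integral_actionDensity_eq_of_differentiableAt ρ hρ hdiff hμ hν hμT hνT

end Registered

end Summit.QuantumFields.YangMills.Theorems.FibreToTorus

end
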